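import Summits.MatrixMultiplication.OmegaCensus.STPPSmallPatternKernelSearch122R
import Summits.MatrixMultiplication.OmegaCensus.STPPSmallPatternKernelProduct

/-!
# ω-census, `(1,2,2)^4` is infeasible in `ℤ/32` — pruned kernel search, part 33

HONEST FRAMING (pub-omega census; verbatim): lottery ticket; floor = certified bounds/negative ranges.
Census STRUCTURE bookkeeping of the STPP track (seat pub-omega-stpp-3, gen 25; STRUCTURE row B5, the threshold column
`T2(H) = max {k : (1,2,2)^k ⊆ H}`, lower side), not progress on `ω`: small patterns in small groups bound no exponent.

Chunks of `STPP122Neg.search2r (zcode 32) 4` (`decide +kernel`, ≈ 288 s predicted): entries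
`(y, c'₀, xb, xb2, XB, XC, PP)` = fixed start, exclusion masks on the codes of `b₁`, `b'₁`, and the forbidden
difference masks of the start's pair-class rank (`STPPSmallPatternKernelReflect122R.lean`); assembled in `STPPSmallPatternNone122K4Z32.lean`.

References: H. Cohn, R. Kleinberg, B. Szegedy, C. Umans, FOCS 2005 (arXiv:math/0511460), Def. 5.1.
-/

set_option Elab.async false
set_option synthInstance.maxSize 8192
set_option synthInstance.maxHeartbeats 800000

namespace Summit.MatrixMultiplication.OmegaCensus

namespace STPP122Neg

open STPP211Neg

/-- Pruned kernel search (min-flag normal form), `ℤ/32`, `k = 4`, start `(y, c'₀) = (16, 1)`: b₁ ∈ [7, 8, 9]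
(≈ 99 s predicted). -/
theorem Z32k4r.x89 : search2r (zcode 32) 4
    [(16, 1, 4294966399, 0, 0, 0, 89875055889960687222909358610021234501026417887380922995950740489506006230483133622298158297363405350101105195023944160448016246406368036559484888917201019809727219757374232973358277634647991850940171587010374670609634535586041317861716210502676497436127212549776343873310921692371001984018287765874012061696)] = true := by
  decide +kernel

/-- Pruned kernel search (min-flag normal form), `ℤ/32`, `k = 4`, start `(y, c'₀) = (16, 1)`: b₁ ∈ [10, 11, 12, 13, 14, 18, 19, 20, 21, 22, 23, 24, 25, 26, 27, 28, 29]
(≈ 96 s predicted). -/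
theorem Z32k4r.x90 : search2r (zcode 32) 4
    [(16, 1, 3221455871, 0, 0, 0, 89875055889960687222909358610021234501026417887380922995950740489506006230483133622298158297363405350101105195023944160448016246406368036559484888917201019809727219757374232973358277634647991850940171587010374670609634535586041317861716210502676497436127212549776343873310921692371001984018287765874012061696)] = true := by
  decide +kernel

/-- Pruned kernel search (min-flag normal form), `ℤ/32`, `k = 4`, start `(y, c'₀) = (1, 15)`: whole start
(≈ 36 s predicted). -/
theorem Z32k4r.x91 : search2r (zcode 32) 4
    [(1, 15, 0, 0, 0, 0, 89877798951995084067251135279837675883967742951083517623496374755965725509580119915148164149461225294524222984647622306005120077635094291474778921519890279934292335678218062756409955335419830701778487392825761923618181757886043279093445152066597113794624485611957265722475884165978512845215115900444183887872)] = true := by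
  decide +kernel

/-- Pruned kernel search (min-flag normal form), `ℤ/32`, `k = 4`, start `(y, c'₀) = (1, 17)`: whole start
(≈ 36 s predicted). -/
theorem Z32k4r.x92 : search2r (zcode 32) 4
    [(1, 17, 0, 0, 0, 0, 89877798951995084067251135279837675883967742951083517623496374755965725509580119915148164149461225294524222984647622306005120077635094291474778921519890279934292335678218062756409955335419830701778487392825761923618181757886043279093445152066597113794624485611957265722475884165978512845215115900444183887872)] = true := by
  decide +kernel

/-- Pruned kernel search (min-flag normal form), `ℤ/32`, `k = 4`, start `(y, c'₀) = (2, 14)`: whole start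
(≈ 21 s predicted). -/
theorem Z32k4r.x93 : search2r (zcode 32) 4
    [(2, 14, 0, 0, 0, 0, 89884656607081076178106413401389798094294117575882673840318202971500559798464743723167718297442265275078563031266332899372145564696086731343298631193801718655987920499423700918678243153765731907180024924026247404774660850711892655786190747811388407553643606010062049574520600296122423107716098727735440965632)] = true := by
  decide +kernel

end STPP122Neg

end Summit.MatrixMultiplication.OmegaCensus
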